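import Summits.HodgeConjecture.HodgeConjecture.Theorems.F0D9opRoad2
import HarnessLib

/-!
# `F0AlbCmStubD9opReceipt` — ★ RECEIPT of the registered stub `stub_D9op` of item 27458 (socket `Cruxes/HLiu418/Lines/F0_AlbCm.lean`)

The «receipt experiment» of LEAD «M-152r» (3) ∕ director s1737 (deal L3-D7, LA3-p01 (g7), 2026-09-03): ONE theorem whose NAME (`stub_D9op`) and
STATEMENT TOKENS (`CorD9OnMOp CMgsm XMgsm`, resolved through the socket's `open Summit.HodgeConjecture.CorCM.Lines.A3Liu418`) are byte-identical to the
registered stub of `stmt-HodgeConjecture-27458` (skeleton `Lines/F0_AlbCm.lean` 6bd7315e7d81), and whose TERM is the ★ head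
`Summit.HodgeConjecture.HodgeConjecture.Cruxes.HLiu418.F0D9opRoad2.stub_D9op_holds` (`Theorems/F0D9opRoad2.lean`, kernel-checked) — filed under `Theorems/`
`--supports stmt-HodgeConjecture-27458` WITHOUT `--as helper`, so that the gate's verdict (ACCEPT with a `supports` record, or a `supports.stub-mismatch` ∕
`dedup.*` bounce) answers whether a ★ twin of a by-name-closed socket stub is received as that stub's landing.  HC_CM is proved only modulo the printed
citations (2 remaining named inputs: hLiu418 = stmt-HodgeConjecture-24832, h413 = stmt-HodgeConjecture-24833) until rung 0 closes; count-neutral.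
-/

set_option autoImplicit false
set_option linter.dupNamespace false  -- `Summit.HodgeConjecture.HodgeConjecture.…` BY DESIGN (D-0017)

namespace Summit.HodgeConjecture.HodgeConjecture.F0AlbCmStubD9opReceipt

open Summit.HodgeConjecture.CorCM.Lines.A3Liu418

/-- **REGISTERED STUB `stub_D9op : CorD9OnMOp CMgsm XMgsm` (item 27458, socket `Lines/F0_AlbCm.lean` :337) — ★ RECEIPT.**  [Liu2021, Cor. D.9] at the
Hecke-OPERATOR level for `M⋆`: the record-curve congruence on points, VERBATIM the head of the child sub-line `F0-D9opRoad2`; the term IS that ★ head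
`…Cruxes.HLiu418.F0D9opRoad2.stub_D9op_holds` (from the one letter `stub_L3 : RecordCurveEichlerShimuraModel` via the kernel-checked `D9op_of_L3`).
[cite: Liu2021, Cor. D.9 p. 138–139 (FJcycle.tex l. 5579–5585); Prop. D.8 p. 135–138] [cite: Carayol1986Compositio, §10.3] -/
theorem stub_D9op : CorD9OnMOp CMgsm XMgsm :=
  Summit.HodgeConjecture.HodgeConjecture.Cruxes.HLiu418.F0D9opRoad2.stub_D9op_holds

end Summit.HodgeConjecture.HodgeConjecture.F0AlbCmStubD9opReceipt
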